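import Summits.QuantumFields.BalabanUV.Beta.EriceFlowEnclosureB12AsPrintedTunedUpper
import Literature.MathematicalPhysics.QuantumFieldTheory.Balaban1983to89.T4CouplingMatching

/-!
# Beta / EriceFlowEnclosureB12AsPrintedHistoryUnique — «g₀ = g₀(ε, g)» IS A FUNCTION in the HISTORY reading of [I]: uniqueness of
# Theorem 2's tuned bare coupling on the as-printed interface from moduli for the dependence of β_{k+1} on the PRECEDING couplings
# with FADING MEMORY (node U2's letters), resp. from a last-only modulus — the history-reading twin of row U's lattice uniqueness
# (β-flow team, prover 1 = recursion ∕ upper ∕ bare-coupling ∕ UNIQUENESS side, unit `b2b-balaban-beta-bflow-p1`, gen 33; ROW AP-I × ROW U;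
# companions `…B12AsPrintedHistoryJump*` (gen 33: the CONTINUITY letter in the preceding couplings is load-bearing for EXISTENCE),
# `…TunedFlow` (#22, row U: Markov uniqueness from the x-modulus), `T4CouplingMatching` (node U2: the moduli `HistLipschitz`,
# `FadingMemory`, `LastOnlyLipschitz` and the two backward Grönwall kernels, for runs of lengths K and K + 1))

HONEST FRAMING (page 1 of everything the β sub-cell writes): discharging `BetaPertH` makes Bałaban's UV stability UNCONDITIONAL — a
real constructive-QFT result; it is NOT the continuum limit and NOT the Clay problem.  HONEST DEPENDENCY (cell reorg 2026-08-19,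
verbatim): «continuum YM on T⁴ ⇐ BetaPertH ∧ nine spine estimates (0/9 proved); BetaPertH ⇐ (D1) ∧ (D4) ∧ CAP+tail; G-an2-4 gates
asym, D1 and NE2/3/4.»  THIS MODULE DISCHARGES NOTHING: bookkeeping from the NAMED FIELDS of the statement-exact typing of [I] =
T. Bałaban, Commun. Math. Phys. **109** (1987) [Balaban1987RG1] (`B12BetaAsPrinted`, p537882 ✓ ∕ v1.1 p539116 ✓) and node U2's HYPOTHESIS
SHAPES `T4CouplingMatching.HistLipschitz Λ γ β` (|β_{k+1}(p) − β_{k+1}(q)| ≤ Σ_i Λ k i |p_i − q_i| on ]0, γ]^{k+1}), `FadingMemory C θ Λ`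
(Λ k i ≤ C θ^{k−i}), `LastOnlyLipschitz L γ β` — NONE printed ([I] p. 298 says only that β_{j} *"depends also on all preceding coupling
constants"*; GAPS G-t4-U2-2) — plus the AF letter `FlowStep.BetaLowerH b` (b > 0; Theorem 2 is STATED WITHOUT PROOF, p. 259) and the
upper letter (U).  Every letter is a hypothesis on an abstract `Setting S`; nothing of Bałaban's objects is asserted.

THE POINT.  [I] Theorem 2 (p. 259) writes the tuned bare coupling in FUNCTION notation, *"g₀ = g₀(ε, g)"*, but asserts existence
only; row U (#22 `…TunedFlow`, #26 `…MaximalTuning`, #29, #30b) settled WHEN it is a function for MARKOV families β_n(g_n²) (Erice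
(3.62)): uniqueness ⇐ the x-modulus ∕ `LastVarLipschitz` with Cγ³ < 2, and fails without a modulus (#23's spike).  In the HISTORY
reading of [I] (p. 298) two runs of the SAME length pinned at the same renormalized g are compared scale by scale; the feedback of
the discrepancy through the preceding couplings is two-sided (δ_{j+1} infrared of j, δ_i ultraviolet of j), exactly node U2's
structure with the scale-shift term absent (c = 0): `hist_step`.  Hence (§11) `runs_eq_of_fadingMemory` (node U2's
`twoSided_fixedPoint` at c = 0: fading memory + the AF weight sum Σ_i g_i² g′_i ≤ γ³ + 2γ∕b + smallness C(γ³ + 2γ∕b) ≤ (1 − θ)∕2 ⟹ the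
two runs COINCIDE at every scale, in particular at the bare end) and `runs_eq_of_lastOnly` (`backward_gronwall` with no source: a
last-only modulus with Lγ³ ≤ ½ suffices, no other smallness); (§12) on the carrier: `bareCoupling_unique_of_fadingMemory ∕
_of_lastOnly`, and the END **`theorem2_existsUnique_of_fadingMemory`**: `Theorem2Statement S hL` + printed `Definitions` + (U) (for the
binder `hrg` of `…TunedUpper.hrg_of_betaUpperH`) + `BetaLowerH b` + `HistLipschitz` with `FadingMemory` ⟹ for every m, small γ, small g and
EVERY K there is EXACTLY ONE bare coupling g₀ whose run stays in ]0, γ] and ends at g_K = g — «g₀ = g₀(ε, g)» is a function.  A uniform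
coordinatewise modulus (`BetaDerivClause.CoordLipschitzAt`, all k, one C) is `HistLipschitz (fun _ _ => C)` WITHOUT fading memory
(`T4CouplingMatching.histLipschitz_of_coordLipschitz` and the remark there) and does NOT feed §11's first theorem; the companion
`…HistoryJump*` shows that with NO modulus in the preceding couplings even EXISTENCE fails.

WHAT THIS FILE PROVES (0 sorry, 0 def):
§11 `hist_step`, **`runs_eq_of_fadingMemory`**, `sum_weights_le` (Σ_{i≤K} g_i² g′_i ≤ γ³ + 2γ∕b along two AF runs of the same length —
    node U2's profile sum BY NAME), **`runs_eq_of_lastOnly`**.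
§12 `bareCoupling_unique_of_fadingMemory`, `bareCoupling_unique_of_lastOnly`, **`theorem2_existsUnique_of_fadingMemory`**,
    `theorem2_existsUnique_of_lastOnly`.
NOT CLAIMED: any modulus, sign or bound for Bałaban's β; Theorem 2; `BetaPertH`; continuum; Clay.
-/

namespace Summit.QuantumFields.BalabanUV.Beta.EriceFlowEnclosureB12AsPrintedHistoryUnique

open Finset
open Literature.MathematicalPhysics.QuantumFieldTheory.Balaban1983to89
open Literature.MathematicalPhysics.QuantumFieldTheory.Balaban1983to89.B12BetaAsPrinted
open Literature.MathematicalPhysics.QuantumFieldTheory.Balaban1983to89.FlowStep (prefixOf Box mem_box box_mono RGEqH BetaLowerH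
  BetaUpperH)
open Literature.MathematicalPhysics.QuantumFieldTheory.Balaban1983to89.T4CouplingMatching (HistLipschitz FadingMemory
  LastOnlyLipschitz twoSided_fixedPoint backward_gronwall abs_sub_le_of_inv_sq inv_sq_lower_of_betaLower prof sprof sprof_pos
  sprof_sq prof_pos sum_profWeights_le)
open Summit.QuantumFields.BalabanUV.Beta.EriceFlowEnclosureB12AsPrintedUpper (tunedRuns_of_theorem2Statement)
open Summit.QuantumFields.BalabanUV.Beta.EriceFlowEnclosureB12AsPrintedTunedUpper (hrg_of_betaUpperH)

noncomputable section

variable {S : Setting}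

/-! ## §11 Two runs of the same length: the discrepancy recursion and two uniqueness theorems -/

/-- **THE SAME-LENGTH DISCREPANCY STEP.**  Two runs g, g′ of (0.20) with the same history-dependent β, K steps each, couplings in
]0, γ], history moduli `HistLipschitz Λ γ S.β` (Λ ≥ 0): with δ_j := |1∕g_j² − 1∕g′_j²|, for j < K
`δ_j ≤ δ_{j+1} + Σ_{i≤j} Λ j i·(g_i² g′_i)·δ_i` ((0.20) for both runs, the moduli, and |g − g′| ≤ g²g′|1∕g² − 1∕g′²|) — node U2's
`disc_step` without the scale-shift term. [cite: Balaban1987RG1, (0.20) p.256 with p.298] -/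
theorem hist_step {γ : ℝ} {Λ : ℕ → ℕ → ℝ} {K : ℕ} {g g' : ℕ → ℝ}
    (hg : RGEqH K S.β g) (hg' : RGEqH K S.β g')
    (hbox : ∀ i, i ≤ K → 0 < g i ∧ g i ≤ γ) (hbox' : ∀ i, i ≤ K → 0 < g' i ∧ g' i ≤ γ)
    (hL : HistLipschitz Λ γ S.β) (hΛ : ∀ k i, i ≤ k → 0 ≤ Λ k i) {j : ℕ} (hj : j < K) :
    |1 / (g j) ^ 2 - 1 / (g' j) ^ 2| ≤ |1 / (g (j + 1)) ^ 2 - 1 / (g' (j + 1)) ^ 2|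
      + ∑ i ∈ range (j + 1), Λ j i * ((g i) ^ 2 * g' i) * |1 / (g i) ^ 2 - 1 / (g' i) ^ 2| := by
  have e := hg j hj
  have e' := hg' j hj
  have hp : prefixOf g j ∈ Box γ j := T4CouplingMatching.prefixOf_mem_box hj.le hbox
  have hp' : prefixOf g' j ∈ Box γ j := T4CouplingMatching.prefixOf_mem_box hj.le hbox'
  have h2 := hL j (prefixOf g j) (prefixOf g' j) hp hp'
  have h3 : ∑ i : Fin (j + 1), Λ j i * |prefixOf g j i - prefixOf g' j i|
      ≤ ∑ i ∈ range (j + 1), Λ j i * ((g i) ^ 2 * g' i) * |1 / (g i) ^ 2 - 1 / (g' i) ^ 2| := by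
    rw [Finset.sum_range (fun i => Λ j i * ((g i) ^ 2 * g' i) * |1 / (g i) ^ 2 - 1 / (g' i) ^ 2|)]
    refine Finset.sum_le_sum fun i _ => ?_
    have hiK : (i : ℕ) ≤ K := by have := i.isLt; omega
    simp only [FlowStep.prefixOf_apply]
    rw [mul_assoc]
    exact mul_le_mul_of_nonneg_left (abs_sub_le_of_inv_sq (hbox i hiK).1 (hbox' i hiK).1)
      (hΛ j i (Nat.lt_succ_iff.mp i.isLt))
  have key : 1 / g j ^ 2 - 1 / g' j ^ 2
      = (1 / g (j + 1) ^ 2 - 1 / g' (j + 1) ^ 2) + (S.β j (prefixOf g j) - S.β j (prefixOf g' j)) := by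
    rw [e, e']; ring
  rw [key]
  exact (abs_add_le _ _).trans (by linarith [h2, h3])

/-- **UNIQUENESS UNDER FADING MEMORY.**  Two runs of (0.20) of the SAME length K with the same β, couplings in ]0, γ], PINNED at the same
renormalized value g_K = g′_K; history moduli with fading memory (`HistLipschitz Λ γ S.β`, `FadingMemory C θ Λ`, 0 < θ < 1); the weight
sum Σ_{i≤K} g_i² g′_i ≤ U and the SMALLNESS C·U ≤ (1 − θ)∕2.  THEN the two runs coincide at every scale j ≤ K — node U2's
`twoSided_fixedPoint` with no source (c = 0) forces δ ≡ 0. [cite: Balaban1987RG1, Thm 2 p.259 («g₀ = g₀(ε, g)») with (0.20) p.256 and p.298] -/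
theorem runs_eq_of_fadingMemory {γ θ C U : ℝ} {Λ : ℕ → ℕ → ℝ} {K : ℕ} {g g' : ℕ → ℝ}
    (hθ0 : 0 < θ) (hθ1 : θ < 1) (hC : 0 ≤ C)
    (hg : RGEqH K S.β g) (hg' : RGEqH K S.β g')
    (hbox : ∀ i, i ≤ K → 0 < g i ∧ g i ≤ γ) (hbox' : ∀ i, i ≤ K → 0 < g' i ∧ g' i ≤ γ) (hpin : g K = g' K)
    (hL : HistLipschitz Λ γ S.β) (hΛ : FadingMemory C θ Λ)
    (hU : ∑ i ∈ range (K + 1), (g i) ^ 2 * g' i ≤ U) (hsmall : C * U ≤ (1 - θ) / 2) :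
    ∀ j, j ≤ K → g j = g' j := by
  set δ : ℕ → ℝ := fun j => |1 / (g j) ^ 2 - 1 / (g' j) ^ 2| with hδ
  have hu : ∀ i, i ≤ K → 0 ≤ (g i) ^ 2 * g' i := fun i hi => mul_nonneg (sq_nonneg _) (hbox' i hi).1.le
  have hK : δ K = 0 := by simp [hδ, hpin]
  have hrec : ∀ j, j < K →
      δ j ≤ δ (j + 1) + 0 * θ ^ j + C * ∑ i ∈ range (j + 1), θ ^ (j - i) * ((g i) ^ 2 * g' i) * δ i := by
    intro j hj
    have hstep := hist_step hg hg' hbox hbox' hL (fun k i hik => (hΛ k i hik).1) hj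
    have hsum : ∑ i ∈ range (j + 1), Λ j i * ((g i) ^ 2 * g' i) * δ i
        ≤ C * ∑ i ∈ range (j + 1), θ ^ (j - i) * ((g i) ^ 2 * g' i) * δ i := by
      rw [Finset.mul_sum]
      refine Finset.sum_le_sum fun i hi => ?_
      have hij : i ≤ j := Nat.lt_succ_iff.mp (mem_range.mp hi)
      have hiK : i ≤ K := by omega
      have hnn : 0 ≤ (g i) ^ 2 * g' i * δ i := mul_nonneg (hu i hiK) (abs_nonneg _)
      calc Λ j i * ((g i) ^ 2 * g' i) * δ i = Λ j i * ((g i) ^ 2 * g' i * δ i) := by ring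
        _ ≤ C * θ ^ (j - i) * ((g i) ^ 2 * g' i * δ i) := mul_le_mul_of_nonneg_right (hΛ j i hij).2 hnn
        _ = C * (θ ^ (j - i) * ((g i) ^ 2 * g' i) * δ i) := by ring
    have h0 : (0 : ℝ) * θ ^ j = 0 := zero_mul _
    simp only [hδ] at hstep hsum ⊢
    linarith [hstep, hsum, h0]
  have hfix := twoSided_fixedPoint (δ := δ) (u := fun i => (g i) ^ 2 * g' i) (c := 0) hθ0 hθ1 le_rfl hC
    (fun j => abs_nonneg _) hu hU hsmall hK hrec
  intro j hj
  have h0 : δ j ≤ 0 := by have := hfix j hj; simpa using this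
  have hδ0 : δ j = 0 := le_antisymm h0 (abs_nonneg _)
  have heq : 1 / (g j) ^ 2 = 1 / (g' j) ^ 2 := by
    have : |1 / (g j) ^ 2 - 1 / (g' j) ^ 2| = 0 := hδ0
    exact sub_eq_zero.mp (abs_eq_zero.mp this)
  have hsq : (g j) ^ 2 = (g' j) ^ 2 := by
    have := congrArg (fun x : ℝ => 1 / x) heq
    simpa only [one_div_one_div] using this
  exact (pow_left_inj₀ (hbox j hj).1.le (hbox' j hj).1.le two_ne_zero).mp hsq

/-- **THE AF WEIGHT SUM FOR TWO RUNS OF THE SAME LENGTH IS K-UNIFORM**: with a lower bound `b ≤ β_{k+1}` on the boxes (`BetaLowerH b γ S.β`,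
b > 0 — the AF letter, UNPRINTED) and couplings in ]0, γ], `Σ_{i≤K} g_i² g′_i ≤ γ³ + 2γ∕b` (each run obeys 1∕g_i² ≥ 1∕γ² + b(K − i) —
`T4CouplingMatching.inv_sq_lower_of_betaLower` —, so the i-th weight is ≤ a_{K−i}^{−3∕2}, a_m = 1∕γ² + b·m, and node U2's telescoped profile sum
`sum_profWeights_le` bounds the total). [cite: Balaban1987RG1, (0.31) p.259] -/
theorem sum_weights_le {γ b : ℝ} {K : ℕ} {g g' : ℕ → ℝ} (hγ : 0 < γ) (hb : 0 < b)
    (hg : RGEqH K S.β g) (hg' : RGEqH K S.β g')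
    (hbox : ∀ i, i ≤ K → 0 < g i ∧ g i ≤ γ) (hbox' : ∀ i, i ≤ K → 0 < g' i ∧ g' i ≤ γ) (hlo : BetaLowerH b γ S.β) :
    ∑ i ∈ range (K + 1), (g i) ^ 2 * g' i ≤ γ ^ 3 + 2 * γ / b := by
  have hp0 := sprof_pos hγ hb.le
  have hpt : ∀ i, i ≤ K → (g i) ^ 2 * g' i ≤ 1 / (sprof γ b (K - i)) ^ 2 * (1 / sprof γ b (K - i)) := by
    intro i hi
    have hgi := hbox i hi
    have hgi' := hbox' i hi
    have hgK := hbox K le_rfl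
    have hgK' := hbox' K le_rfl
    have hAK : 1 / γ ^ 2 ≤ 1 / (g K) ^ 2 :=
      one_div_le_one_div_of_le (pow_pos hgK.1 2) (pow_le_pow_left₀ hgK.1.le hgK.2 2)
    have hBK : 1 / γ ^ 2 ≤ 1 / (g' K) ^ 2 :=
      one_div_le_one_div_of_le (pow_pos hgK'.1 2) (pow_le_pow_left₀ hgK'.1.le hgK'.2 2)
    have h1 := inv_sq_lower_of_betaLower hg hbox hlo hi
    have h2 := inv_sq_lower_of_betaLower hg' hbox' hlo hi
    have ha : prof γ b (K - i) ≤ 1 / (g i) ^ 2 := by unfold T4CouplingMatching.prof; linarith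
    have ha' : prof γ b (K - i) ≤ 1 / (g' i) ^ 2 := by unfold T4CouplingMatching.prof; linarith
    have hsq : (g i) ^ 2 ≤ 1 / (sprof γ b (K - i)) ^ 2 := by
      rw [sprof_sq hγ hb.le, le_one_div (pow_pos hgi.1 2) (prof_pos hγ hb.le _)]; exact ha
    have hsq' : (g' i) ^ 2 ≤ (1 / sprof γ b (K - i)) ^ 2 := by
      rw [one_div_pow, sprof_sq hγ hb.le, le_one_div (pow_pos hgi'.1 2) (prof_pos hγ hb.le _)]; exact ha'
    have h' : g' i ≤ 1 / sprof γ b (K - i) :=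
      (pow_le_pow_iff_left₀ hgi'.1.le (one_div_pos.mpr (hp0 _)).le two_ne_zero).mp hsq'
    exact mul_le_mul hsq h' hgi'.1.le (by positivity)
  calc ∑ i ∈ range (K + 1), (g i) ^ 2 * g' i
      ≤ ∑ i ∈ range (K + 1), 1 / (sprof γ b (K - i)) ^ 2 * (1 / sprof γ b (K - i)) :=
        Finset.sum_le_sum fun i hi => hpt i (Nat.lt_succ_iff.mp (mem_range.mp hi))
    _ ≤ γ ^ 3 + 2 * γ / b := sum_profWeights_le hγ hb K

/-- **UNIQUENESS UNDER A LAST-ONLY MODULUS (the Markov-type feedback; no smallness beyond Lγ³ ≤ ½).**  Two runs of the same length K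
with the same β, couplings in ]0, γ], pinned g_K = g′_K, and `LastOnlyLipschitz L γ S.β` with `L·γ³ ≤ ½`: the runs coincide at every scale —
node U2's `backward_gronwall` with no source (δ_j ≤ δ_{j+1} + L g_j² g′_j·δ_j, δ_K = 0 ⟹ δ ≡ 0).  Compare row U's lattice uniqueness
(#22 `…TunedFlow.tunedRun_unique`: the x-modulus with Cγ³ < 2). [cite: Balaban1987RG1, Thm 2 p.259 («g₀ = g₀(ε, g)») with (0.20) p.256] -/
theorem runs_eq_of_lastOnly {γ L : ℝ} {K : ℕ} {g g' : ℕ → ℝ} (hL0 : 0 ≤ L) (hLγ : L * γ ^ 3 ≤ 1 / 2)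
    (hg : RGEqH K S.β g) (hg' : RGEqH K S.β g')
    (hbox : ∀ i, i ≤ K → 0 < g i ∧ g i ≤ γ) (hbox' : ∀ i, i ≤ K → 0 < g' i ∧ g' i ≤ γ) (hpin : g K = g' K)
    (hLip : LastOnlyLipschitz L γ S.β) : ∀ j, j ≤ K → g j = g' j := by
  set δ : ℕ → ℝ := fun j => |1 / (g j) ^ 2 - 1 / (g' j) ^ 2| with hδ
  set ℓ : ℕ → ℝ := fun j => if j < K then L * ((g j) ^ 2 * g' j) else 0 with hℓ
  have hK : δ K = 0 := by simp [hδ, hpin]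
  have hw : ∀ j, j < K → 0 ≤ (g j) ^ 2 * g' j ∧ (g j) ^ 2 * g' j ≤ γ ^ 3 := by
    intro j hj
    have hgj := hbox j hj.le
    have hgj' := hbox' j hj.le
    refine ⟨mul_nonneg (sq_nonneg _) hgj'.1.le, ?_⟩
    calc (g j) ^ 2 * g' j ≤ γ ^ 2 * γ := mul_le_mul (pow_le_pow_left₀ hgj.1.le hgj.2 2) hgj'.2 hgj'.1.le (sq_nonneg γ)
      _ = γ ^ 3 := by ring
  have hℓ0 : ∀ j, 0 ≤ ℓ j := by
    intro j
    by_cases hj : j < K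
    · simp only [hℓ, if_pos hj]; exact mul_nonneg hL0 (hw j hj).1
    · simp only [hℓ, if_neg hj]; exact le_rfl
  have hℓ1 : ∀ j, ℓ j ≤ 1 / 2 := by
    intro j
    by_cases hj : j < K
    · simp only [hℓ, if_pos hj]
      exact (mul_le_mul_of_nonneg_left (hw j hj).2 hL0).trans hLγ
    · simp only [hℓ, if_neg hj]; norm_num
  have hrec : ∀ j, j < K → δ j ≤ δ (j + 1) + 0 + ℓ j * δ j := by
    intro j hj
    have e := hg j hj
    have e' := hg' j hj
    have hgj := hbox j hj.le
    have hgj' := hbox' j hj.le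
    have hp : prefixOf g j ∈ Box γ j := T4CouplingMatching.prefixOf_mem_box hj.le hbox
    have hp' : prefixOf g' j ∈ Box γ j := T4CouplingMatching.prefixOf_mem_box hj.le hbox'
    have h2 := hLip j (prefixOf g j) (prefixOf g' j) hp hp'
    simp only [FlowStep.prefixOf_apply, Fin.val_last] at h2
    have h3 : |g j - g' j| ≤ (g j) ^ 2 * g' j * δ j := abs_sub_le_of_inv_sq hgj.1 hgj'.1
    have key : 1 / g j ^ 2 - 1 / g' j ^ 2
        = (1 / g (j + 1) ^ 2 - 1 / g' (j + 1) ^ 2) + (S.β j (prefixOf g j) - S.β j (prefixOf g' j)) := by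
      rw [e, e']; ring
    have hℓj : ℓ j = L * ((g j) ^ 2 * g' j) := by simp only [hℓ, if_pos hj]
    have hmain : δ j ≤ δ (j + 1) + L * ((g j) ^ 2 * g' j) * δ j := by
      show |1 / g j ^ 2 - 1 / g' j ^ 2| ≤ |1 / g (j + 1) ^ 2 - 1 / g' (j + 1) ^ 2| + L * ((g j) ^ 2 * g' j) * δ j
      rw [key]
      refine (abs_add_le _ _).trans ?_
      have h4 : L * |g j - g' j| ≤ L * ((g j) ^ 2 * g' j * δ j) := mul_le_mul_of_nonneg_left h3 hL0
      linarith
    rw [hℓj, add_zero]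
    exact hmain
  have hgron := backward_gronwall (δ := δ) (e := fun _ => 0) (ℓ := ℓ) (fun j => abs_nonneg _) (fun _ => le_rfl)
    hℓ0 hℓ1 hK hrec
  intro j hj
  have h0 : δ j ≤ 0 := by have := hgron j hj; simpa using this
  have hδ0 : δ j = 0 := le_antisymm h0 (abs_nonneg _)
  have heq : 1 / (g j) ^ 2 = 1 / (g' j) ^ 2 := by
    have : |1 / (g j) ^ 2 - 1 / (g' j) ^ 2| = 0 := hδ0
    exact sub_eq_zero.mp (abs_eq_zero.mp this)
  have hsq : (g j) ^ 2 = (g' j) ^ 2 := by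
    have := congrArg (fun x : ℝ => 1 / x) heq
    simpa only [one_div_one_div] using this
  exact (pow_left_inj₀ (hbox j hj).1.le (hbox' j hj).1.le two_ne_zero).mp hsq

/-! ## §12 On the carrier: the bare coupling of an in-interval run with prescribed renormalized value is unique -/

/-- **«g₀(ε, g)» IS A FUNCTION UNDER FADING MEMORY.**  For a setting with the printed `Definitions` ((0.18): runs start at their bare
coupling): two runs (K, m, g₀), (K, m, g₀′) obeying (0.20) (`RGEqH`), staying in ]0, γ] and ending at the SAME renormalized coupling
g_K = g′_K have the SAME bare coupling (and coincide at every scale), provided `HistLipschitz Λ γ S.β` with `FadingMemory C θ Λ`, the AF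
letter `BetaLowerH b γ S.β` (b > 0) and the smallness `C(γ³ + 2γ∕b) ≤ (1 − θ)∕2`. [cite: Balaban1987RG1, Thm 2 p.259 («g₀ = g₀(ε, g)») with (0.18)–(0.20) pp.255–256 and p.298] -/
theorem bareCoupling_unique_of_fadingMemory (hD : Definitions S) {γ θ C b : ℝ} {Λ : ℕ → ℕ → ℝ}
    (hθ0 : 0 < θ) (hθ1 : θ < 1) (hC : 0 ≤ C) (hγ : 0 < γ) (hb : 0 < b)
    (hL : HistLipschitz Λ γ S.β) (hΛ : FadingMemory C θ Λ) (hlo : BetaLowerH b γ S.β)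
    (hsmall : C * (γ ^ 3 + 2 * γ / b) ≤ (1 - θ) / 2) {K m : ℕ} {g₀ g₀' : ℝ}
    (hrg : RGEqH K S.β (S.cpl ⟨K, m, g₀⟩)) (hrg' : RGEqH K S.β (S.cpl ⟨K, m, g₀'⟩))
    (hI : Step.InInterval γ K (S.cpl ⟨K, m, g₀⟩)) (hI' : Step.InInterval γ K (S.cpl ⟨K, m, g₀'⟩))
    (hpin : S.cpl ⟨K, m, g₀⟩ K = S.cpl ⟨K, m, g₀'⟩ K) :
    g₀ = g₀' ∧ ∀ j, j ≤ K → S.cpl ⟨K, m, g₀⟩ j = S.cpl ⟨K, m, g₀'⟩ j := by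
  have hall := runs_eq_of_fadingMemory hθ0 hθ1 hC hrg hrg' hI hI' hpin hL hΛ
    (sum_weights_le hγ hb hrg hrg' hI hI' hlo) hsmall
  refine ⟨?_, hall⟩
  have h0 := hall 0 (Nat.zero_le K)
  rwa [hD.d018, hD.d018] at h0

/-- **«g₀(ε, g)» IS A FUNCTION UNDER A LAST-ONLY MODULUS** (`LastOnlyLipschitz L γ S.β`, `L·γ³ ≤ ½`; no AF letter needed). [cite: Balaban1987RG1, Thm 2 p.259 («g₀ = g₀(ε, g)») with (0.18)–(0.20) pp.255–256] -/
theorem bareCoupling_unique_of_lastOnly (hD : Definitions S) {γ L : ℝ} (hL0 : 0 ≤ L) (hLγ : L * γ ^ 3 ≤ 1 / 2)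
    (hLip : LastOnlyLipschitz L γ S.β) {K m : ℕ} {g₀ g₀' : ℝ}
    (hrg : RGEqH K S.β (S.cpl ⟨K, m, g₀⟩)) (hrg' : RGEqH K S.β (S.cpl ⟨K, m, g₀'⟩))
    (hI : Step.InInterval γ K (S.cpl ⟨K, m, g₀⟩)) (hI' : Step.InInterval γ K (S.cpl ⟨K, m, g₀'⟩))
    (hpin : S.cpl ⟨K, m, g₀⟩ K = S.cpl ⟨K, m, g₀'⟩ K) :
    g₀ = g₀' ∧ ∀ j, j ≤ K → S.cpl ⟨K, m, g₀⟩ j = S.cpl ⟨K, m, g₀'⟩ j := by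
  have hall := runs_eq_of_lastOnly hL0 hLγ hrg hrg' hI hI' hpin hLip
  refine ⟨?_, hall⟩
  have h0 := hall 0 (Nat.zero_le K)
  rwa [hD.d018, hD.d018] at h0

/-- **END — THEOREM 2's «g₀ = g₀(ε, g)» EXISTS AND IS UNIQUE, IN THE HISTORY READING, UNDER FADING MEMORY.**  `Theorem2Statement S hL`
([I] Theorem 2 AS PRINTED, a HYPOTHESIS), the printed `Definitions`, the box-wide upper letter `β_{k+1} ≤ b′` on ]0, γ_u]^{k+1} (whence
(0.20) holds INSIDE the interval along every in-interval run for γ with b′γ² < 1 — `…TunedUpper.hrg_of_betaUpperH`), the AF letter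
`b ≤ β_{k+1}` on ]0, γ_u]^{k+1} (b > 0), history moduli `HistLipschitz Λ γ_u S.β` with `FadingMemory C θ Λ`, and a box size γ₁ ≤ γ_u with
b′γ₁² < 1 and C(γ₁³ + 2γ₁∕b) ≤ (1 − θ)∕2 ⟹ for every m there is γ₂ > 0 such that for every γ ≤ γ₂ there is g₁ > 0 such that for every
g ∈ ]0, g₁] and EVERY K there is EXACTLY ONE bare coupling g₀ whose run (K, m, g₀) stays in ]0, γ] and ends at g_K = g.  Existence is
Theorem 2's; uniqueness is §11.  A REDUCTION over UNPRINTED letters; nothing of [I] asserted. [cite: Balaban1987RG1, Thm 2 (0.31) p.259 with (0.20) p.256 and p.298] -/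
theorem theorem2_existsUnique_of_fadingMemory {hL : Odd S.L ∧ 1 < S.L} (h : Theorem2Statement S hL) (hD : Definitions S)
    {γu γ₁ b b' θ C : ℝ} {Λ : ℕ → ℕ → ℝ} (hup : BetaUpperH b' γu S.β) (hlo : BetaLowerH b γu S.β) (hb : 0 < b)
    (hL' : HistLipschitz Λ γu S.β) (hΛ : FadingMemory C θ Λ) (hθ0 : 0 < θ) (hθ1 : θ < 1) (hC : 0 ≤ C)
    (hγ₁ : 0 < γ₁) (hγ₁u : γ₁ ≤ γu) (hbu : b' * γ₁ ^ 2 < 1) (hsmall : C * (γ₁ ^ 3 + 2 * γ₁ / b) ≤ (1 - θ) / 2) (m : ℕ) :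
    ∃ γ₂ : ℝ, 0 < γ₂ ∧ ∀ γ : ℝ, 0 < γ → γ ≤ γ₂ → ∃ g₁ : ℝ, 0 < g₁ ∧ ∀ g : ℝ, 0 < g → g ≤ g₁ → ∀ K : ℕ,
      ∃! g₀ : ℝ, Step.InInterval γ K (S.cpl ⟨K, m, g₀⟩) ∧ S.cpl ⟨K, m, g₀⟩ K = g := by
  obtain ⟨γ₀, hγ₀, hγ⟩ := tunedRuns_of_theorem2Statement h m
  refine ⟨min γ₀ γ₁, lt_min hγ₀ hγ₁, fun γ hγpos hγle => ?_⟩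
  have hγ₀le : γ ≤ γ₀ := hγle.trans (min_le_left _ _)
  have hγ₁le : γ ≤ γ₁ := hγle.trans (min_le_right _ _)
  have hγule : γ ≤ γu := hγ₁le.trans hγ₁u
  obtain ⟨g₁, hg₁, hg⟩ := hγ γ hγpos hγ₀le
  refine ⟨g₁, hg₁, fun g hgpos hgle K => ?_⟩
  obtain ⟨β, β', -, -, hK⟩ := hg g hgpos hgle
  obtain ⟨g₀, hI, hend, -⟩ := hK K
  -- the letters on the smaller box ]0, γ]
  have hup' : BetaUpperH b' γ S.β := fun k v hv => hup k v (box_mono hγule k hv)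
  have hlo' : BetaLowerH b γ S.β := fun k v hv => hlo k v (box_mono hγule k hv)
  have hLγ : HistLipschitz Λ γ S.β := fun k p q hp hq => hL' k p q (box_mono hγule k hp) (box_mono hγule k hq)
  have hγsq : γ ^ 2 ≤ γ₁ ^ 2 := pow_le_pow_left₀ hγpos.le hγ₁le 2
  have hbγ : b' * γ ^ 2 < 1 := by
    rcases le_or_gt 0 b' with hb' | hb'
    · exact lt_of_le_of_lt (mul_le_mul_of_nonneg_left hγsq hb') hbu
    · nlinarith [sq_nonneg γ]
  have hmono : γ ^ 3 + 2 * γ / b ≤ γ₁ ^ 3 + 2 * γ₁ / b :=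
    add_le_add (pow_le_pow_left₀ hγpos.le hγ₁le 3)
      (div_le_div_of_nonneg_right (by linarith) hb.le)
  have hsmallγ : C * (γ ^ 3 + 2 * γ / b) ≤ (1 - θ) / 2 := (mul_le_mul_of_nonneg_left hmono hC).trans hsmall
  refine ⟨g₀, ⟨hI, hend⟩, fun y hy => ?_⟩
  obtain ⟨hIy, hendy⟩ := hy
  exact (bareCoupling_unique_of_fadingMemory hD hθ0 hθ1 hC hγpos hb hLγ hΛ hlo' hsmallγ
    (hrg_of_betaUpperH hD hγpos hup' hbγ ⟨K, m, y⟩ hIy) (hrg_of_betaUpperH hD hγpos hup' hbγ ⟨K, m, g₀⟩ hI)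
    hIy hI (hendy.trans hend.symm)).1

/-- **END, MARKOV-TYPE FEEDBACK — THEOREM 2's «g₀ = g₀(ε, g)» EXISTS AND IS UNIQUE UNDER A LAST-ONLY MODULUS.**  `Theorem2Statement S hL`, the
printed `Definitions`, the upper letter `β_{k+1} ≤ b′` on ]0, γ_u]^{k+1}, `LastOnlyLipschitz L γ_u S.β` and a box size γ₁ ≤ γ_u with
b′γ₁² < 1 and Lγ₁³ ≤ ½ ⟹ for every m, small γ, small g and EVERY K: exactly one bare coupling with an in-interval run ending at g.  (No
AF letter and no further smallness: the history-reading form of row U's #22 `tunedRun_unique`.) [cite: Balaban1987RG1, Thm 2 (0.31) p.259 with (0.20) p.256] -/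
theorem theorem2_existsUnique_of_lastOnly {hL : Odd S.L ∧ 1 < S.L} (h : Theorem2Statement S hL) (hD : Definitions S)
    {γu γ₁ b' L : ℝ} (hup : BetaUpperH b' γu S.β) (hL0 : 0 ≤ L) (hLip : LastOnlyLipschitz L γu S.β)
    (hγ₁ : 0 < γ₁) (hγ₁u : γ₁ ≤ γu) (hbu : b' * γ₁ ^ 2 < 1) (hLγ₁ : L * γ₁ ^ 3 ≤ 1 / 2) (m : ℕ) :
    ∃ γ₂ : ℝ, 0 < γ₂ ∧ ∀ γ : ℝ, 0 < γ → γ ≤ γ₂ → ∃ g₁ : ℝ, 0 < g₁ ∧ ∀ g : ℝ, 0 < g → g ≤ g₁ → ∀ K : ℕ,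
      ∃! g₀ : ℝ, Step.InInterval γ K (S.cpl ⟨K, m, g₀⟩) ∧ S.cpl ⟨K, m, g₀⟩ K = g := by
  obtain ⟨γ₀, hγ₀, hγ⟩ := tunedRuns_of_theorem2Statement h m
  refine ⟨min γ₀ γ₁, lt_min hγ₀ hγ₁, fun γ hγpos hγle => ?_⟩
  have hγ₀le : γ ≤ γ₀ := hγle.trans (min_le_left _ _)
  have hγ₁le : γ ≤ γ₁ := hγle.trans (min_le_right _ _)
  have hγule : γ ≤ γu := hγ₁le.trans hγ₁u
  obtain ⟨g₁, hg₁, hg⟩ := hγ γ hγpos hγ₀le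
  refine ⟨g₁, hg₁, fun g hgpos hgle K => ?_⟩
  obtain ⟨β, β', -, -, hK⟩ := hg g hgpos hgle
  obtain ⟨g₀, hI, hend, -⟩ := hK K
  have hup' : BetaUpperH b' γ S.β := fun k v hv => hup k v (box_mono hγule k hv)
  have hLipγ : LastOnlyLipschitz L γ S.β := fun k p q hp hq => hLip k p q (box_mono hγule k hp) (box_mono hγule k hq)
  have hγsq : γ ^ 2 ≤ γ₁ ^ 2 := pow_le_pow_left₀ hγpos.le hγ₁le 2
  have hbγ : b' * γ ^ 2 < 1 := by
    rcases le_or_gt 0 b' with hb' | hb'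
    · exact lt_of_le_of_lt (mul_le_mul_of_nonneg_left hγsq hb') hbu
    · nlinarith [sq_nonneg γ]
  have hLγ : L * γ ^ 3 ≤ 1 / 2 := (mul_le_mul_of_nonneg_left (pow_le_pow_left₀ hγpos.le hγ₁le 3) hL0).trans hLγ₁
  refine ⟨g₀, ⟨hI, hend⟩, fun y hy => ?_⟩
  obtain ⟨hIy, hendy⟩ := hy
  exact (bareCoupling_unique_of_lastOnly hD hL0 hLγ hLipγ
    (hrg_of_betaUpperH hD hγpos hup' hbγ ⟨K, m, y⟩ hIy) (hrg_of_betaUpperH hD hγpos hup' hbγ ⟨K, m, g₀⟩ hI)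
    hIy hI (hendy.trans hend.symm)).1

end

end Summit.QuantumFields.BalabanUV.Beta.EriceFlowEnclosureB12AsPrintedHistoryUnique
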